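import Summits.BirchSwinnertonDyer.BirchSwinnertonDyer.Theorems.CMKolyvaginAtInertTwoFrobeniusBridgeAtTwo
import Summits.BirchSwinnertonDyer.Rank1Residual.X12.CMRamifiedAdditive
import Literature.NumberTheory.EllipticCurves.ModularityVersionApProofs
import Literature.NumberTheory.EllipticCurves.HeegnerPointReflectionProofs
import HarnessLib

/-!
# Route `CMKolyvaginAtInertTwo`, cruxes `CMPrimitiveSupplyAtInertTwo` (stmt-BirchSwinnertonDyer-24276)
# and `CMKolyvaginExactAtInertTwo` (24277): Kolyvagin's two (H2) NON-SQUARE CONDITIONS ARE AUTOMATIC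
# on the habitat H₂ — `d_K·(−|Δ|)` and `d_K·(−2|Δ|)` are never rational squares

Seat `bsd-line-cmk2-p1` g3 (cell `bsd-print-cf2`); helper (`--supports stmt-BirchSwinnertonDyer-24276`;
equally a simplification of 24277's hypotheses). THEOREMS ONLY: no definition, no named fact, no
`sorry`; no item is closed; BSD is not proved by any of this.

The supply crux 24276 asks for a Heegner field `K` (imaginary quadratic, odd `d_K ≠ −3`, every
`q ∣ N_E` split) that ALSO satisfies Kolyvagin's two exclusions
`¬ IsSquare (d_K · (−|Δ_E|))` and `¬ IsSquare (d_K · (−2|Δ_E|))` (W. Zhang 2014 / Kolyvagin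
1989 Thm. B: `K ⊄ ℚ(E[2^∞])`, i.e. `K ≠ ℚ(√Δ), ℚ(√2Δ)` up to the sign normalisation), and the
exactness crux 24277 carries them as hypotheses. On H₂ (`HasCM`, `CMInert W 2`, `ρ̄_{E,2}` onto)
both are CONSEQUENCES of the other binders, so the pen may drop them (g0's HANDOFF noted the first;
this file proves both):

* `not_isSquare_discr_mul_neg_two_mul_abs_Δ_of_cmInert_two` — for ANY `K` with odd `d_K`:
  `Δ = d_F·s²` with `d_F < 0` odd (`KolyvaginFrobeniusTwo.exists_Δ_eq_cmFieldDiscr_mul_sq_of_cmInert_two`,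
  and `2 ∤ d_F` is the `¬CMRamified W 2` half of `CMInert W 2`), so `d_K·(−2|Δ|) = 2·d_K·d_F·s²`
  has odd `2`-adic valuation;
* `not_isSquare_discr_mul_neg_abs_Δ_of_cmInert_two_of_heegner` — under the Heegner hypothesis for
  `N_E`: `d_K·(−|Δ|) = d_K·d_F·s²`, and `d_F = −q` with `q ∈ {3, 11, 19, 43, 67, 163}` prime;
  the CM prime `q` is bad for `E` (tree `X12.not_good_of_hasCM_of_dvd_cmFieldDiscrOfJ`), so
  `q ∣ N_E` (`dvd_conductorNorm_iff_not_hasGoodReductionAtPrime`), so `q` splits in `K` and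
  `q ∤ d_K` (`not_dvd_discr_of_satisfiesHeegnerHypothesis`); but `d_K·d_F = m²` with `q ∥ d_F`
  forces `q ∣ d_K`.
* `not_isSquare_and_of_cmInert_two_of_heegner` — both, in the binder shape of 24276/24277.

References: [GrossLMS1991] §1, §3 (3.1); [WZhang2014] Notations; [Kolyvagin1989] Thm. B (the
exclusions `K ≠ ℚ(√−|Δ|), ℚ(√−2|Δ|)`); [SilvermanAEC2009] VII.5, C.11 (CM primes are bad);
[SilvermanATAEC1994] App. A §3.
-/

-- single-conjunct summit: `Summit.BirchSwinnertonDyer.BirchSwinnertonDyer.…` repeats the name by design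
set_option linter.dupNamespace false
set_option autoImplicit false

noncomputable section

open scoped Classical

namespace Summit.BirchSwinnertonDyer.BirchSwinnertonDyer.Theorems.KolyvaginFrobeniusTwo

open WeierstrassCurve NumberField
open Literature.NumberTheory.EllipticCurves Literature.NumberTheory.EllipticCurves.Rank1Residual
open Summit.BirchSwinnertonDyer.BirchSwinnertonDyer.Theorems.KolyvaginEigenTwo

variable (W : WeierstrassCurve ℚ) [W.IsElliptic]

/-- `2·(odd)` is not the square of an integer. [folklore] -/
theorem not_isSquare_two_mul_of_odd {n : ℤ} (hn : Odd n) : ¬ IsSquare (2 * n) := by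
  rintro ⟨m, hm⟩
  rcases Int.even_or_odd m with ⟨t, ht⟩ | hmodd
  · -- `m = 2t`: `2n = 4t²`, `n = 2t²` even
    have : n = 2 * (t * t) := by
      have h2 : (2 : ℤ) * n = 2 * (2 * (t * t)) := by rw [hm, ht]; ring
      exact mul_left_cancel₀ two_ne_zero h2
    exact (Int.not_even_iff_odd.mpr hn) ⟨t * t, by rw [this]; ring⟩
  · -- `m` odd: `m²` odd but `2n` even
    have hodd : Odd (m * m) := hmodd.mul hmodd
    rw [← hm] at hodd
    exact (Int.not_even_iff_odd.mpr hodd) (even_two_mul n)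

/-- **The second (H2) exclusion is automatic on H₂.** For `W/ℚ` with CM, `2` inert in the CM field
(`CMInert W 2`), `ρ̄_{W,2}` onto, and ANY number field `K` with odd discriminant:
`d_K · (−2|Δ(W)|)` is not a rational square (`= 2·d_K·d_F·s²` with `d_K`, `d_F` odd, `s ≠ 0`).
[cite: Kolyvagin1989Izv, Thm. B (field exclusions)] [cite: SilvermanATAEC1994, App. A §3] -/
theorem not_isSquare_discr_mul_neg_two_mul_abs_Δ_of_cmInert_two (hCM : W.HasCM) (hin : CMInert W 2)
    (hsurj : W.HasSurjectiveModNGaloisRep 2) (K : Type) [Field K] [NumberField K]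
    (hodd : Odd (NumberField.discr K)) :
    ¬ IsSquare ((NumberField.discr K : ℚ) * (-(2 * |W.Δ|))) := by
  obtain ⟨hneg, s, hs⟩ := exists_Δ_eq_cmFieldDiscr_mul_sq_of_cmInert_two W hCM hin hsurj
  set dF : ℤ := cmFieldDiscrOfJ W.j with hdF
  have hΔ0 : W.Δ ≠ 0 := by rw [← coe_Δ']; exact W.Δ'.ne_zero
  have hs0 : s ≠ 0 := by rintro rfl; apply hΔ0; rw [hs]; ring
  have hΔneg : W.Δ < 0 := Δ_neg_of_cmInert_two W hCM hin hsurj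
  have habs : |W.Δ| = -W.Δ := abs_of_neg hΔneg
  -- `d_F` odd: `2 ∤ d_F` is `¬ CMRamified W 2`
  have hdFodd : Odd dF := by
    rw [← Int.not_even_iff_odd, even_iff_two_dvd]
    exact_mod_cast hin.1
  rintro ⟨r, hr⟩
  -- `2 d_K d_F = (r/s)²`
  have hsq : IsSquare (((2 * (NumberField.discr K * dF) : ℤ)) : ℚ) := by
    refine ⟨r / s, ?_⟩
    have : (NumberField.discr K : ℚ) * (-(2 * |W.Δ|)) = 2 * (NumberField.discr K * dF) * s ^ 2 := by
      rw [habs, hs]; ring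
    rw [div_mul_div_comm, ← hr, this]
    push_cast
    field_simp
  rw [Rat.isSquare_intCast_iff] at hsq
  exact not_isSquare_two_mul_of_odd (hodd.mul hdFodd) hsq

/-- On `CMInert W 2` (eight CM `j`-invariants): `d_F = −q` for a prime `q ∈ {3, 11, 19, 43, 67, 163}`
with `q ≠ 2`. [cite: SilvermanATAEC1994, App. A §3 (table of CM j-invariants)] -/
theorem exists_prime_cmFieldDiscr_eq_neg_of_cmInert_two (hin : CMInert W 2) :
    ∃ q : ℕ, q.Prime ∧ q ≠ 2 ∧ cmFieldDiscrOfJ W.j = -(q : ℤ) := by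
  rcases j_mem_of_cmInert_two W hin with hj | hj | hj | hj | hj | hj | hj | hj
  · exact ⟨3, by norm_num, by norm_num, by rw [hj]; unfold cmFieldDiscrOfJ; norm_num⟩
  · exact ⟨3, by norm_num, by norm_num, by rw [hj]; unfold cmFieldDiscrOfJ; norm_num⟩
  · exact ⟨3, by norm_num, by norm_num, by rw [hj]; unfold cmFieldDiscrOfJ; norm_num⟩
  · exact ⟨11, by norm_num, by norm_num, by rw [hj]; unfold cmFieldDiscrOfJ; norm_num⟩
  · exact ⟨19, by norm_num, by norm_num, by rw [hj]; unfold cmFieldDiscrOfJ; norm_num⟩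
  · exact ⟨43, by norm_num, by norm_num, by rw [hj]; unfold cmFieldDiscrOfJ; norm_num⟩
  · exact ⟨67, by norm_num, by norm_num, by rw [hj]; unfold cmFieldDiscrOfJ; norm_num⟩
  · exact ⟨163, by norm_num, by norm_num, by rw [hj]; unfold cmFieldDiscrOfJ; norm_num⟩

/-- **The CM prime divides the conductor**: for `W/ℚ` with CM and `CMInert W 2`, the prime
`q = |d_F|` divides `N_E` (CM primes ramified in `F` are primes of bad — additive — reduction,
tree `X12.not_good_of_hasCM_of_dvd_cmFieldDiscrOfJ`; `q ∣ N_E ⟺ bad at q`).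
[cite: SilvermanAEC2009, Cor. VII.7.2] [cite: BurungaleFlach2024, proof of Cor. 2] -/
theorem cmPrime_dvd_conductorNorm_of_cmInert_two [W.IsGloballyMinimal] (hCM : W.HasCM)
    {q : ℕ} (hq : q.Prime) (hq2 : q ≠ 2) (hdF : cmFieldDiscrOfJ W.j = -(q : ℤ)) :
    q ∣ W.conductorNorm ℤ := by
  haveI : Fact q.Prime := ⟨hq⟩
  rw [dvd_conductorNorm_iff_not_hasGoodReductionAtPrime]
  exact Summit.BirchSwinnertonDyer.Rank1Residual.X12.not_good_of_hasCM_of_dvd_cmFieldDiscrOfJ W hCM q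
    hq2 (by rw [hdF]; exact (dvd_neg.mpr dvd_rfl))

/-- **The first (H2) exclusion is automatic on H₂ under the Heegner hypothesis.** For `W/ℚ`
globally minimal with CM, `CMInert W 2`, `ρ̄_{W,2}` onto, and `K` imaginary quadratic satisfying
the Heegner hypothesis for `N_E`: `d_K · (−|Δ(W)|)` is not a rational square. (`= d_K·d_F·s²`;
the CM prime `q = −d_F` divides `N_E`, hence splits in `K`, hence `q ∤ d_K`; a square `d_K·d_F`
with `q ∥ d_F` would force `q ∣ d_K`.)
[cite: Kolyvagin1989Izv, Thm. B (field exclusions)] [cite: GrossLMS1991, §1 (Heegner hypothesis)] -/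
theorem not_isSquare_discr_mul_neg_abs_Δ_of_cmInert_two_of_heegner [W.IsGloballyMinimal]
    (hCM : W.HasCM) (hin : CMInert W 2) (hsurj : W.HasSurjectiveModNGaloisRep 2)
    (K : Type) [Field K] [NumberField K] (hK : IsImaginaryQuadratic K)
    (hH : SatisfiesHeegnerHypothesis (W.conductorNorm ℤ) K) :
    ¬ IsSquare ((NumberField.discr K : ℚ) * -|W.Δ|) := by
  obtain ⟨hneg, s, hs⟩ := exists_Δ_eq_cmFieldDiscr_mul_sq_of_cmInert_two W hCM hin hsurj
  obtain ⟨q, hq, hq2, hdF⟩ := exists_prime_cmFieldDiscr_eq_neg_of_cmInert_two W hin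
  have hΔ0 : W.Δ ≠ 0 := by rw [← coe_Δ']; exact W.Δ'.ne_zero
  have hs0 : s ≠ 0 := by rintro rfl; apply hΔ0; rw [hs]; ring
  have hΔneg : W.Δ < 0 := Δ_neg_of_cmInert_two W hCM hin hsurj
  have habs : |W.Δ| = -W.Δ := abs_of_neg hΔneg
  -- `q ∣ N_E`, so `q ∤ d_K`
  have hqN : q ∣ W.conductorNorm ℤ := cmPrime_dvd_conductorNorm_of_cmInert_two W hCM hq hq2 hdF
  have hqdK : ¬ (q : ℤ) ∣ NumberField.discr K := not_dvd_discr_of_satisfiesHeegnerHypothesis hK hH hq hqN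
  rintro ⟨r, hr⟩
  -- `d_K · d_F = (r/s)²` is an integer square `m²`
  have hsq : IsSquare (((NumberField.discr K * cmFieldDiscrOfJ W.j : ℤ)) : ℚ) := by
    refine ⟨r / s, ?_⟩
    have : (NumberField.discr K : ℚ) * -|W.Δ| = (NumberField.discr K * cmFieldDiscrOfJ W.j) * s ^ 2 := by
      rw [habs, hs]; ring
    rw [div_mul_div_comm, ← hr, this]
    push_cast
    field_simp
  rw [Rat.isSquare_intCast_iff] at hsq
  obtain ⟨m, hm⟩ := hsq
  rw [hdF] at hm
  -- `q ∣ m²` so `q ∣ m`, `q² ∣ m² = -q·d_K`, `q ∣ d_K`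
  have hqZ : Prime (q : ℤ) := Nat.prime_iff_prime_int.mp hq
  have hqm : (q : ℤ) ∣ m := by
    have : (q : ℤ) ∣ m * m := ⟨-NumberField.discr K, by rw [← hm]; ring⟩
    exact (hqZ.dvd_or_dvd this).elim id id
  obtain ⟨t, ht⟩ := hqm
  apply hqdK
  refine ⟨-(t * t), ?_⟩
  have h1 : (q : ℤ) * (NumberField.discr K * -1) = (q : ℤ) * (q * (t * t)) := by
    have := hm
    rw [ht] at this
    linear_combination this
  have hq0 : (q : ℤ) ≠ 0 := by exact_mod_cast hq.ne_zero
  have h2 := mul_left_cancel₀ hq0 h1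
  linear_combination -h2

/-- **Both (H2) exclusions on H₂, in the binder shape of cruxes 24276/24277**: for `W/ℚ` globally
minimal with CM, `CMInert W 2`, `ρ̄_{W,2}` onto, and `K` imaginary quadratic with odd `d_K`
satisfying the Heegner hypothesis for `N_E`:
`¬ IsSquare (d_K·(−|Δ|)) ∧ ¬ IsSquare (d_K·(−2|Δ|))`. So these two binders of
`CMKolyvaginExactAtInertTwo` / conjuncts of `CMPrimitiveSupplyAtInertTwo` are redundant on the
habitat. [cite: Kolyvagin1989Izv, Thm. B (field exclusions)] [cite: GrossLMS1991, §1] -/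
theorem not_isSquare_and_of_cmInert_two_of_heegner [W.IsGloballyMinimal]
    (hCM : W.HasCM) (hin : CMInert W 2) (hsurj : W.HasSurjectiveModNGaloisRep 2)
    (K : Type) [Field K] [NumberField K] (hK : IsImaginaryQuadratic K)
    (hodd : Odd (NumberField.discr K)) (hH : SatisfiesHeegnerHypothesis (W.conductorNorm ℤ) K) :
    ¬ IsSquare ((NumberField.discr K : ℚ) * -|W.Δ|) ∧
      ¬ IsSquare ((NumberField.discr K : ℚ) * (-(2 * |W.Δ|))) :=
  ⟨not_isSquare_discr_mul_neg_abs_Δ_of_cmInert_two_of_heegner W hCM hin hsurj K hK hH,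
    not_isSquare_discr_mul_neg_two_mul_abs_Δ_of_cmInert_two W hCM hin hsurj K hodd⟩

end Summit.BirchSwinnertonDyer.BirchSwinnertonDyer.Theorems.KolyvaginFrobeniusTwo

end
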